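import Mathlib.Analysis.SpecialFunctions.Pow.Real
import Mathlib.Tactic
import HarnessLib

/-!
# The eigenvalue algebra of the compact shrinker classification (Eminenti–La Nave–Mantegazza, §3)

The purely algebraic step of the classification of compact three-dimensional shrinking Ricci
solitons by the maximum principle for `λ_min(Ric)/R` (Eminenti–La Nave–Mantegazza 2008, §3,
p. 7). At the minimum point of `λ_min/R` one obtains the inequality

  `0 ≤ R³ − nλR² + 2(n−1)λ²R − (n−1)SR + (n−1)(n−2)λS`,  `λ = λ_min`, `S = |Ric|²`,

and, writing `R = λ + R̃`, `S = λ² + S̃` with `R̃`, `S̃` the sum and the sum of squares of the other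
eigenvalues, the printed computation factors the right-hand side as

  `(n−2)λ²((n−1)λ − R̃) + ((n−3)λ − R̃)((n−1)S̃ − R̃²)`

and concludes, for `R > 0`, that it is non-positive, hence zero, which happens only if either
`λ = 0` and the other eigenvalues coincide, or all eigenvalues coincide. We PROVE this for `n = 3`
(two other eigenvalues `a ≤ b`, `R̃ = a + b`, `S̃ = a² + b²`, `(n−1)S̃ − R̃² = (a − b)²`):

* `ELM.cubic_eq` — the factorisation identity (general `n`, as printed);
* `ELM.cubic_three_eq` — its `n = 3` form `λ²(2λ − a − b) − (a + b)(a − b)²`;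
* `ELM.cubic_three_nonpos` — non-positivity when `λ ≤ a ≤ b` and `λ + a + b > 0`;
* **`ELM.eigenvalues_of_cubic_three_nonneg`** — if moreover the expression is `≥ 0` then
  `(λ = 0 ∧ a = b) ∨ (λ = a ∧ a = b)` (the two cases of the printed proof).

## References

* M. Eminenti, G. La Nave, C. Mantegazza, *Ricci solitons: the equation point of view*,
  manuscripta math. 127 (2008) 345–367, §3 (p. 7). [EminentiLanaveMantegazza2008]
-/

namespace Literature.Geometry.Riemannian

namespace ELM

/-- **The factorisation of Eminenti–La Nave–Mantegazza** (§3, p. 7, the displayed computation):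
with `R = λ + R̃` and `S = λ² + S̃`,
`R³ − nλR² + 2(n−1)λ²R − (n−1)SR + (n−1)(n−2)λS
  = (n−2)λ²((n−1)λ − R̃) + ((n−3)λ − R̃)((n−1)S̃ − R̃²)`.
[cite: EminentiLanaveMantegazza2008, §3 (p. 7)] -/
theorem cubic_eq (n lam Rt St : ℝ) :
    (lam + Rt) ^ 3 - n * lam * (lam + Rt) ^ 2 + 2 * (n - 1) * lam ^ 2 * (lam + Rt)
        - (n - 1) * (lam ^ 2 + St) * (lam + Rt) + (n - 1) * (n - 2) * lam * (lam ^ 2 + St) =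
      (n - 2) * lam ^ 2 * ((n - 1) * lam - Rt) + ((n - 3) * lam - Rt) * ((n - 1) * St - Rt ^ 2) := by
  ring

/-- The `n = 3` form with the other two eigenvalues `a, b` (`R̃ = a + b`, `S̃ = a² + b²`,
`2S̃ − R̃² = (a − b)²`): the expression equals `λ²(2λ − a − b) − (a + b)(a − b)²`.
[cite: EminentiLanaveMantegazza2008, §3 (p. 7)] -/
theorem cubic_three_eq (lam a b : ℝ) :
    (lam + (a + b)) ^ 3 - 3 * lam * (lam + (a + b)) ^ 2 + 2 * (3 - 1) * lam ^ 2 * (lam + (a + b))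
        - (3 - 1) * (lam ^ 2 + (a ^ 2 + b ^ 2)) * (lam + (a + b))
        + (3 - 1) * (3 - 2) * lam * (lam ^ 2 + (a ^ 2 + b ^ 2)) =
      lam ^ 2 * (2 * lam - a - b) - (a + b) * (a - b) ^ 2 := by
  ring

/-- **Non-positivity** (§3, p. 7: "as `R` is positive, both terms `(λ(n−1) − R̃)` and
`((n−3)λ − R̃)` are nonpositive … the term `((n−1)S̃ − R̃²)` must be nonnegative, so … all this
expression is nonpositive"), `n = 3`: for `λ ≤ a ≤ b` with `λ + a + b > 0`,
`λ²(2λ − a − b) − (a + b)(a − b)² ≤ 0`. [cite: EminentiLanaveMantegazza2008, §3 (p. 7)] -/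
theorem cubic_three_nonpos {lam a b : ℝ} (hla : lam ≤ a) (hab : a ≤ b) (hpos : 0 < lam + a + b) :
    lam ^ 2 * (2 * lam - a - b) - (a + b) * (a - b) ^ 2 ≤ 0 := by
  have hsum : 0 ≤ a + b := by
    by_contra h
    have h' : a + b < 0 := lt_of_not_ge h
    nlinarith
  have h1 : lam ^ 2 * (2 * lam - a - b) ≤ 0 :=
    mul_nonpos_of_nonneg_of_nonpos (sq_nonneg lam) (by linarith)
  have h2 : 0 ≤ (a + b) * (a - b) ^ 2 := mul_nonneg hsum (sq_nonneg _)
  linarith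

/-- **The two cases** (§3, p. 7: "Hence, it must be zero … There are only two possibilities this can
happen: either `λ_min(p) = 0` and all the other `n − 1` eigenvalues of the Ricci tensor are equal,
or all the eigenvalues are equal"), `n = 3`: if `λ ≤ a ≤ b`, `λ + a + b > 0` and the expression is
`≥ 0`, then `λ = 0 ∧ a = b` or `λ = a = b`. [cite: EminentiLanaveMantegazza2008, §3 (p. 7)] -/
theorem eigenvalues_of_cubic_three_nonneg {lam a b : ℝ} (hla : lam ≤ a) (hab : a ≤ b)
    (hpos : 0 < lam + a + b) (h : 0 ≤ lam ^ 2 * (2 * lam - a - b) - (a + b) * (a - b) ^ 2) :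
    (lam = 0 ∧ a = b) ∨ (lam = a ∧ a = b) := by
  have hsum : 0 ≤ a + b := by
    by_contra h'
    have h'' : a + b < 0 := lt_of_not_ge h'
    nlinarith
  have h1 : lam ^ 2 * (2 * lam - a - b) ≤ 0 :=
    mul_nonpos_of_nonneg_of_nonpos (sq_nonneg lam) (by linarith)
  have h2 : 0 ≤ (a + b) * (a - b) ^ 2 := mul_nonneg hsum (sq_nonneg _)
  have e1 : lam ^ 2 * (2 * lam - a - b) = 0 := by linarith
  have e2 : (a + b) * (a - b) ^ 2 = 0 := by linarith
  -- `a = b`: if `a + b = 0` then `b ≥ 0 ≥ a ≥ λ` contradicts `λ + a + b > 0` unless excluded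
  have hab' : a = b := by
    rcases mul_eq_zero.mp e2 with h3 | h3
    · exfalso
      have hb : 0 ≤ b := by linarith
      nlinarith
    · nlinarith [sq_nonneg (a - b), pow_eq_zero_iff (n := 2) (two_ne_zero) |>.mp h3]
  rcases mul_eq_zero.mp e1 with h4 | h4
  · exact Or.inl ⟨pow_eq_zero_iff (two_ne_zero) |>.mp h4, hab'⟩
  · right
    refine ⟨by linarith, hab'⟩

end ELM

end Literature.Geometry.Riemannian
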